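import Summits.ResolutionOfSingularities.ResolutionOfSingularities.Theorems.HilbertSamuelEliminationCampaignW42RidgeConeNear
import Literature.RingTheory.Length.LengthEqFinrank
import HarnessLib

/-!
# [OURS · L1 W4.2] The cone theorem in the tree's Hilbert–Samuel vocabulary: `dim_K S/(I + 𝔪^{d+1})`
# is `H⁽¹⁾` of the graded ring `S/I`, `dim_K S/(I + 𝔪_v^{d+1})` is `H⁽¹⁾` of the local ring of the cone
# at its rational point `v`; hence `F(C)(K) = {v ∈ C(K) | H⁽⁰⁾(𝒪_{C,v}) = H⁽⁰⁾(𝒪_{C,0})}` (campaign s42 of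
# cell res-hironaka, LADDER-RESOLUTION rung L; informal crux `RidgeConfinement`,
# stmt-ResolutionOfSingularities-17845; `--supports`)

HONEST FRAMING. OURS (slot W4.2, prover res-L1-s42-pv-1, gen 2): the dictionary between the
`K`-dimensions `dim_K S/(I + 𝔪_v^{d+1})` in which `…CampaignW42RidgeConeNear.lean` states the cone theorem
(a rational point of a cone at which the Hilbert–Samuel function does not drop lies in Giraud's ridge)
and the Hilbert(–Samuel) functions of the tree: `Literature.RingTheory.HilbertSamuel.hilbertFunQuot`
(CJS Def. 2.11, the Hilbert function of a standard graded algebra `S/I`) and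
`Literature.RingTheory.HilbertSamuel.hilbertFun` / `hilbertSamuelFun` (CJS §2.2, `H⁽ᵗ⁾_𝒪` of a
local ring; CJS Def. 2.28 `H_X(x)` is built from these). NOTHING here is a statement of
H. Hironaka's manuscript [Hironaka2017]. AI review is weaker than expert review.

## Content (`S = K[X_1, …, X_n]`, `𝔪 = MvPolynomial.idealOfVars`, `I` homogeneous, `C = V(I)`, `v ∈ C(K)`)

* `finite_quotient_sup_pow`; `finrank_range_jet_eq_sum`, `finrank_inf_restrictTotalDegree_eq_sum`;
  **`finrank_quotient_sup_pow_eq_psum_hilbertFunQuot`: `dim_K S/(I + 𝔪^{d+1}) = Σ_{e ≤ d} H(S/I)(e)`** and its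
  base-change invariance `finrank_quotient_coneIdeal_sup_pow_eq` (CJS Rem. 2.12 (a), tree `hilbertFunQuot_map`);
* **`hilbertSamuelFun_one_eq_finrank_quotient_pow`** — `H⁽¹⁾_{R_𝔑}(d) = dim_K R/𝔑^{d+1}` for a `K`-rational
  maximal ideal `𝔑` (`R = K + 𝔑`) of a `K`-algebra `R` (Mathlib `equivQuotMaximalIdealPow`; length = dimension
  for residually rational local algebras, `Literature.RingTheory.Length`); for the cone
  `hilbertSamuelFun_one_localization_cone_eq`: `H⁽¹⁾(𝒪_{C,v})(d) = dim_K S/(I + 𝔪_v^{d+1})`, and at the vertex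
  **`hilbertFun_localization_vertex_eq_hilbertFunQuot`: `H⁽⁰⁾(𝒪_{C,0}) = H(S/I)`**;
* **`mem_ridge_iff_hilbertSamuelFun_eq`, `mem_ridge_iff_hilbertFun_eq`**:
  `v ∈ F(C)(K) ↔ H⁽¹⁾(𝒪_{C,v}) = H⁽¹⁾(𝒪_{C,0}) ↔ H⁽⁰⁾(𝒪_{C,v}) = H⁽⁰⁾(𝒪_{C,0})`;
  `hilbertSamuelFun_one_localization_cone_le` (`H⁽¹⁾(𝒪_{C,v}) ≤ H⁽¹⁾(𝒪_{C,0})`), `mem_ridge_of_hilbertSamuelFun_le`.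

References (orientation only): V. Cossart, U. Jannsen, S. Saito, LNM 2270 (2020), Def. 2.11, Rem. 2.12 (a),
§2.2 (p. 27), Def. 2.28, Def. 3.13; H. Hironaka, Ann. of Math. 92 (1970); J. Giraud, Ann. Sci. ÉNS 8
(1975) §1.5; W. Fulton, *Intersection Theory*, App. A.1.
-/

noncomputable section

-- single-conjunct summit: the doubled namespace component `ResolutionOfSingularities` is mandated
set_option linter.dupNamespace false

open MvPolynomial Module IsLocalRing
open Literature.RingTheory.MvPolynomial (shift shift_X shift_shift shift_zero shift_injective eval_shift
  totalDegree_shift_le idealDegree)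
open Literature.RingTheory.HilbertSamuel
open Literature.AlgebraicGeometry.Resolution

namespace Summit.ResolutionOfSingularities.ResolutionOfSingularities.Theorems

namespace CampaignW42

universe u v

variable {K : Type u} [Field K] {n : ℕ}

/-! ## Finite-dimensionality of `S/(J + 𝔪^{d+1})` -/

/-- `S/(J + 𝔪^{d+1})` is spanned by the classes of the `d`-jets, hence finite-dimensional. [folklore] -/
theorem finite_quotient_sup_pow (J : Ideal (MvPolynomial (Fin n) K)) (d : ℕ) :
    Module.Finite K (MvPolynomial (Fin n) K ⧸ (J ⊔ idealOfVars (Fin n) K ^ (d + 1))) := by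
  haveI := finite_range_jet (K := K) (n := n) d
  set P : Ideal (MvPolynomial (Fin n) K) := J ⊔ idealOfVars (Fin n) K ^ (d + 1)
  let ψ : LinearMap.range (jet K n d) →ₗ[K] (MvPolynomial (Fin n) K ⧸ P) :=
    (P.restrictScalars K).mkQ ∘ₗ (LinearMap.range (jet K n d)).subtype
  refine Module.Finite.of_surjective
    ((Submodule.Quotient.restrictScalarsEquiv K P).toLinearMap ∘ₗ ψ) ?_
  rw [LinearMap.coe_comp]
  refine (Submodule.Quotient.restrictScalarsEquiv K P).surjective.comp fun q => ?_
  obtain ⟨f, rfl⟩ := Submodule.mkQ_surjective _ q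
  refine ⟨⟨jet K n d f, LinearMap.mem_range_self _ f⟩, ?_⟩
  change (P.restrictScalars K).mkQ (jet K n d f) = (P.restrictScalars K).mkQ f
  rw [← sub_eq_zero, ← map_sub, Submodule.mkQ_apply, Submodule.Quotient.mk_eq_zero,
    Submodule.restrictScalars_mem]
  refine Ideal.mem_sup_right ?_
  rw [← jet_eq_zero_iff, map_sub, jet_eq_self_of_totalDegree_le (totalDegree_jet_le d f), sub_self]

/-- `S/(J + 𝔪_v^{d+1})` is finite-dimensional for the ideal `𝔪_v = ker(eval v)` of a rational point.
[folklore] -/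
theorem finite_quotient_sup_ker_eval_pow (J : Ideal (MvPolynomial (Fin n) K)) (v : Fin n → K) (d : ℕ) :
    Module.Finite K (MvPolynomial (Fin n) K ⧸ (J ⊔ RingHom.ker (eval v) ^ (d + 1))) := by
  haveI := finite_quotient_sup_pow (J.map (shift v)) d
  have hIJ : J.map (shift v) ⊔ idealOfVars (Fin n) K ^ (d + 1) =
      (J ⊔ RingHom.ker (eval v) ^ (d + 1)).map
        (shiftEquiv v : MvPolynomial (Fin n) K →+* MvPolynomial (Fin n) K) := by
    rw [← map_shift_sup_ker_eval_pow]
    rfl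
  exact Module.Finite.equiv (Ideal.quotientEquivAlg _ _ (shiftEquiv v) hIJ).toLinearEquiv.symm

/-! ## `dim_K S/(I + 𝔪^{d+1}) = Σ_{e ≤ d} H(S/I)(e)` -/

/-- `jet_{d+1}(S) = jet_d(S) + S_{d+1}`. [folklore] -/
theorem range_jet_succ (d : ℕ) :
    LinearMap.range (jet K n (d + 1)) =
      LinearMap.range (jet K n d) ⊔ homogeneousSubmodule (Fin n) K (d + 1) := by
  refine le_antisymm ?_ (sup_le ?_ ?_)
  · rintro _ ⟨f, rfl⟩
    have h : jet K n (d + 1) f = jet K n d f + homogeneousComponent (d + 1) f := by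
      rw [homogeneousComponent_succ_eq_jet_sub, add_sub_cancel]
    rw [h]
    exact Submodule.add_mem_sup (LinearMap.mem_range_self _ f) (homogeneousComponent_mem _ f)
  · rintro _ ⟨f, rfl⟩
    exact ⟨jet K n d f, jet_eq_self_of_totalDegree_le ((totalDegree_jet_le d f).trans (Nat.le_succ d))⟩
  · intro p hp
    exact ⟨p, jet_eq_self_of_totalDegree_le ((mem_homogeneousSubmodule _ _).mp hp).totalDegree_le⟩

/-- `jet_d(S) ∩ S_{d+1} = 0`. [folklore] -/
theorem range_jet_inf_homogeneousSubmodule_succ (d : ℕ) :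
    LinearMap.range (jet K n d) ⊓ homogeneousSubmodule (Fin n) K (d + 1) = ⊥ := by
  rw [eq_bot_iff]
  rintro p ⟨⟨f, rfl⟩, hp⟩
  rw [Submodule.mem_bot, ← homogeneousComponent_eq_self ((mem_homogeneousSubmodule _ _).mp hp)]
  exact homogeneousComponent_eq_zero _ _ (Nat.lt_succ_of_le (totalDegree_jet_le d f))

/-- `jet_0(S) = S_0`. [folklore] -/
theorem range_jet_zero : LinearMap.range (jet K n 0) = homogeneousSubmodule (Fin n) K 0 := by
  refine le_antisymm ?_ fun p hp => ?_
  · rintro _ ⟨f, rfl⟩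
    rw [jet_zero_eq]
    exact homogeneousComponent_mem 0 f
  · exact ⟨p, jet_eq_self_of_totalDegree_le ((mem_homogeneousSubmodule _ _).mp hp).totalDegree_le⟩

/-- The graded pieces `S_e` are finite-dimensional. [folklore] -/
theorem finite_homogeneousSubmodule (e : ℕ) : Module.Finite K (homogeneousSubmodule (Fin n) K e) :=
  Module.Finite.iff_fg.mpr (homogeneousSubmodule_fg _ _ e)

/-- **`dim_K jet_d(S) = Σ_{e ≤ d} dim_K S_e`.** [folklore] -/
theorem finrank_range_jet_eq_sum (d : ℕ) :
    finrank K (LinearMap.range (jet K n d)) =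
      ∑ e ∈ Finset.range (d + 1), finrank K (homogeneousSubmodule (Fin n) K e) := by
  induction d with
  | zero => rw [range_jet_zero, zero_add, Finset.sum_range_one]
  | succ d ih =>
    haveI := finite_range_jet (K := K) (n := n) d
    haveI := finite_homogeneousSubmodule (K := K) (n := n) (d + 1)
    have h := Submodule.finrank_sup_add_finrank_inf_eq (LinearMap.range (jet K n d))
      (homogeneousSubmodule (Fin n) K (d + 1))
    rw [range_jet_inf_homogeneousSubmodule_succ, finrank_bot, add_zero, ← range_jet_succ] at h
    rw [h, Finset.sum_range_succ, ih]

/-- `I ∩ S_{≤ d+1} = (I ∩ S_{≤d}) + I_{d+1}` for a homogeneous ideal. [folklore] -/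
theorem inf_restrictTotalDegree_succ {I : Ideal (MvPolynomial (Fin n) K)} (hI : IsHomogeneousIdeal I) (d : ℕ) :
    I.restrictScalars K ⊓ restrictTotalDegree (Fin n) K (d + 1) =
      (I.restrictScalars K ⊓ restrictTotalDegree (Fin n) K d) ⊔ idealDegree I (d + 1) := by
  refine le_antisymm ?_ (sup_le ?_ ?_)
  · rintro f ⟨hfI, hfd⟩
    have h : f = jet K n d f + homogeneousComponent (d + 1) f := by
      rw [homogeneousComponent_succ_eq_jet_sub, add_sub_cancel,
        jet_eq_self_of_totalDegree_le ((mem_restrictTotalDegree _ _ _).mp hfd)]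
    rw [h]
    refine Submodule.add_mem_sup ⟨jet_mem_of_isHomogeneousIdeal hI hfI d,
      (mem_restrictTotalDegree _ _ _).mpr (totalDegree_jet_le d f)⟩ ?_
    exact ⟨hI f hfI (d + 1), homogeneousComponent_isHomogeneous (d + 1) f⟩
  · rintro f ⟨hfI, hfd⟩
    exact ⟨hfI, (mem_restrictTotalDegree _ _ _).mpr
      (((mem_restrictTotalDegree _ _ _).mp hfd).trans (Nat.le_succ d))⟩
  · rintro f ⟨hfI, hfd⟩
    exact ⟨hfI, (mem_restrictTotalDegree _ _ _).mpr (MvPolynomial.IsHomogeneous.totalDegree_le hfd)⟩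

/-- `(I ∩ S_{≤d}) ∩ I_{d+1} = 0`. [folklore] -/
theorem inf_restrictTotalDegree_inf_idealDegree_succ (I : Ideal (MvPolynomial (Fin n) K)) (d : ℕ) :
    (I.restrictScalars K ⊓ restrictTotalDegree (Fin n) K d) ⊓ idealDegree I (d + 1) = ⊥ := by
  rw [eq_bot_iff]
  rintro p ⟨⟨-, hpd⟩, -, hp⟩
  rw [Submodule.mem_bot, ← homogeneousComponent_eq_self hp]
  exact homogeneousComponent_eq_zero _ _ (Nat.lt_succ_of_le ((mem_restrictTotalDegree _ _ _).mp hpd))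

/-- `I ∩ S_{≤0} = I_0`. [folklore] -/
theorem inf_restrictTotalDegree_zero (I : Ideal (MvPolynomial (Fin n) K)) :
    I.restrictScalars K ⊓ restrictTotalDegree (Fin n) K 0 = idealDegree I 0 := by
  ext p
  simp only [Submodule.mem_inf, Submodule.restrictScalars_mem, mem_restrictTotalDegree,
    Literature.RingTheory.MvPolynomial.mem_idealDegree, Nat.le_zero, ← totalDegree_zero_iff_isHomogeneous]

/-- **`dim_K (I ∩ S_{≤d}) = Σ_{e ≤ d} dim_K I_e`** for a homogeneous ideal. [folklore] -/
theorem finrank_inf_restrictTotalDegree_eq_sum {I : Ideal (MvPolynomial (Fin n) K)}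
    (hI : IsHomogeneousIdeal I) (d : ℕ) :
    finrank K ↥(I.restrictScalars K ⊓ restrictTotalDegree (Fin n) K d) =
      ∑ e ∈ Finset.range (d + 1), finrank K (idealDegree I e) := by
  induction d with
  | zero => rw [inf_restrictTotalDegree_zero, zero_add, Finset.sum_range_one]
  | succ d ih =>
    haveI : Module.Finite K ↥(I.restrictScalars K ⊓ restrictTotalDegree (Fin n) K d) :=
      Module.Finite.of_injective (Submodule.inclusion inf_le_right) (Submodule.inclusion_injective _)
    have h := Submodule.finrank_sup_add_finrank_inf_eq
      (I.restrictScalars K ⊓ restrictTotalDegree (Fin n) K d) (idealDegree I (d + 1))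
    rw [inf_restrictTotalDegree_inf_idealDegree_succ, finrank_bot, add_zero,
      ← inf_restrictTotalDegree_succ hI] at h
    rw [h, Finset.sum_range_succ, ih]

/-- **`dim_K S/(I + 𝔪^{d+1}) = Σ_{e ≤ d} H(S/I)(e)`**: the Hilbert–Samuel numbers of the cone at its vertex
are the partial sums `H(S/I)⁽¹⁾` of the Hilbert function `hilbertFunQuot` of the graded ring `S/I`
(CJS Def. 2.11 / §2.2). [cite: CossartJannsenSaito2020, Def. 2.11] -/
theorem finrank_quotient_sup_pow_eq_psum_hilbertFunQuot {I : Ideal (MvPolynomial (Fin n) K)}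
    (hI : IsHomogeneousIdeal I) (d : ℕ) :
    finrank K (MvPolynomial (Fin n) K ⧸ (I ⊔ idealOfVars (Fin n) K ^ (d + 1))) =
      psum (hilbertFunQuot K n I) d := by
  have h1 := finrank_quotient_add_finrank_map_jet I d
  rw [map_jet_eq_of_isHomogeneousIdeal hI, finrank_range_jet_eq_sum,
    finrank_inf_restrictTotalDegree_eq_sum hI] at h1
  have h2 : ∑ e ∈ Finset.range (d + 1), hilbertFunQuot K n I e =
      ∑ e ∈ Finset.range (d + 1), finrank K (homogeneousSubmodule (Fin n) K e) -
        ∑ e ∈ Finset.range (d + 1), finrank K (idealDegree I e) := by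
    rw [← Finset.sum_tsub_distrib]
    · rfl
    · intro e _
      haveI := finite_homogeneousSubmodule (K := K) (n := n) e
      exact Submodule.finrank_mono (inf_le_right : idealDegree I e ≤ homogeneousSubmodule (Fin n) K e)
  rw [psum_apply, h2]
  omega

/-- **Base change of the vertex numbers**: `dim_κ κ[X]/(I κ[X] + 𝔪^{d+1}) = dim_K K[X]/(I + 𝔪^{d+1})` for
every field extension `κ ⊇ K` (the Hilbert function of `S/I` is invariant under base change, CJS
Rem. 2.12 (a), tree `hilbertFunQuot_map`). [cite: CossartJannsenSaito2020, Rem. 2.12 (a)] -/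
theorem finrank_quotient_coneIdeal_sup_pow_eq {κ : Type v} [Field κ] [Algebra K κ]
    {I : Ideal (MvPolynomial (Fin n) K)} (hI : IsHomogeneousIdeal I) (d : ℕ) :
    finrank κ (MvPolynomial (Fin n) κ ⧸ (coneIdeal κ I ⊔ idealOfVars (Fin n) κ ^ (d + 1))) =
      finrank K (MvPolynomial (Fin n) K ⧸ (I ⊔ idealOfVars (Fin n) K ^ (d + 1))) := by
  rw [coneIdeal, finrank_quotient_sup_pow_eq_psum_hilbertFunQuot (isHomogeneousIdeal_map (algebraMap K κ) hI),
    finrank_quotient_sup_pow_eq_psum_hilbertFunQuot hI, hilbertFunQuot_map (algebraMap K κ) hI]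

/-! ## `H⁽¹⁾` of the local ring at a rational point is `dim_K R/𝔑^{d+1}` -/

section RationalPoint

variable {R : Type u} [CommRing R] [Algebra K R] (𝔑 : Ideal R) [𝔑.IsMaximal]
  (L : Type u) [CommRing L] [Algebra R L] [Algebra K L] [IsScalarTower K R L]
  [IsLocalization.AtPrime L 𝔑] [IsLocalRing L] [IsNoetherianRing L]

omit [IsNoetherianRing L] in
/-- At a `K`-rational point (`R = K + 𝔑`) every element of the local ring `L = R_𝔑` is a scalar modulo
`𝔪_L`. [folklore] -/
theorem exists_sub_algebraMap_mem_maximalIdeal (hrat : ∀ r : R, ∃ c : K, r - algebraMap K R c ∈ 𝔑)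
    (ℓ : L) : ∃ c : K, ℓ - algebraMap K L c ∈ maximalIdeal L := by
  have h𝔑L : 𝔑.map (algebraMap R L) = maximalIdeal L := IsLocalization.AtPrime.map_eq_maximalIdeal 𝔑 L
  obtain ⟨q, hq⟩ := (IsLocalization.AtPrime.equivQuotMaximalIdeal 𝔑 L).surjective
    (Ideal.Quotient.mk (maximalIdeal L) ℓ)
  obtain ⟨r, rfl⟩ := Ideal.Quotient.mk_surjective q
  rw [IsLocalization.AtPrime.equivQuotMaximalIdeal_apply_mk, Ideal.Quotient.mk_eq_mk_iff_sub_mem] at hq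
  obtain ⟨c, hc⟩ := hrat r
  refine ⟨c, ?_⟩
  have h1 : algebraMap R L r - algebraMap K L c ∈ maximalIdeal L := by
    rw [IsScalarTower.algebraMap_apply K R L, ← map_sub, ← h𝔑L]
    exact Ideal.mem_map_of_mem _ hc
  have h2 : ℓ - algebraMap K L c = (algebraMap R L r - algebraMap K L c) - (algebraMap R L r - ℓ) := by
    ring
  rw [h2]
  exact Ideal.sub_mem _ h1 hq

/-- **`H⁽¹⁾_{R_𝔑}(d) = dim_K R/𝔑^{d+1}`** for a `K`-rational maximal ideal `𝔑` (`R = K + 𝔑`) of a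
`K`-algebra `R` and any localization `L` of `R` at `𝔑` (Noetherian local): `H⁽¹⁾_L(d) = ℓ_L(L/𝔪_L^{d+1})`
(CJS §2.2), `L/𝔪_L^{d+1} ≅ R/𝔑^{d+1}` (Mathlib `IsLocalization.AtPrime.equivQuotMaximalIdealPow`), and
length over the residually rational local `K`-algebra `L` is `K`-dimension (Fulton, App. A.1).
[cite: CossartJannsenSaito2020, §2.2 (p. 27)] -/
theorem hilbertSamuelFun_one_eq_finrank_quotient_pow (hrat : ∀ r : R, ∃ c : K, r - algebraMap K R c ∈ 𝔑)
    (d : ℕ) [Module.Finite K (R ⧸ 𝔑 ^ (d + 1))] :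
    hilbertSamuelFun L 1 d = finrank K (R ⧸ 𝔑 ^ (d + 1)) := by
  set JL : Ideal L := maximalIdeal L ^ (d + 1)
  -- `R/𝔑^{d+1} ≃ L/𝔪_L^{d+1}`, `K`-linearly
  haveI : IsScalarTower K R (L ⧸ JL) := IsScalarTower.of_algebraMap_eq fun c => by
    change Ideal.Quotient.mk JL (algebraMap K L c) = Ideal.Quotient.mk JL (algebraMap R L (algebraMap K R c))
    rw [IsScalarTower.algebraMap_apply K R L]
  let e : (R ⧸ 𝔑 ^ (d + 1)) ≃ₗ[K] L ⧸ JL :=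
    ((IsLocalization.AtPrime.equivQuotMaximalIdealPow 𝔑 L (d + 1)).toLinearEquiv).restrictScalars K
  haveI : Module.Finite K (L ⧸ JL) := Module.Finite.equiv e
  haveI : IsScalarTower K L (L ⧸ JL) := Ideal.Quotient.isScalarTower K L JL
  have hresL := exists_sub_algebraMap_mem_maximalIdeal (K := K) 𝔑 L hrat
  have h1 : (hilbertSamuelFun L 1 d : ℕ∞) = Module.length L (L ⧸ JL) := hilbertSamuelFun_one_eq_length L d
  rw [Literature.RingTheory.Length.length_eq_finrank_of_residueField hresL (L ⧸ JL), ← e.finrank_eq] at h1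
  exact_mod_cast h1

end RationalPoint

/-! ## The cone: `H⁽¹⁾(𝒪_{C,v})(d) = dim_K S/(I + 𝔪_v^{d+1})` -/

/-- The ideal `𝔪_v/I` of a rational point `v ∈ C(K)` of `Spec(S/I)` is maximal. [folklore] -/
theorem isMaximal_map_ker_eval {I : Ideal (MvPolynomial (Fin n) K)} {v : Fin n → K}
    (hv : I ≤ RingHom.ker (eval v)) :
    ((RingHom.ker (eval v)).map (Ideal.Quotient.mk I)).IsMaximal := by
  have hmax : (RingHom.ker (eval (σ := Fin n) v)).IsMaximal :=
    RingHom.ker_isMaximal_of_surjective (eval v) fun c => ⟨C c, eval_C c⟩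
  refine (Ideal.map_eq_top_or_isMaximal_of_surjective _ Ideal.Quotient.mk_surjective hmax).resolve_left
    fun htop => hmax.ne_top ?_
  have h := Ideal.comap_map_of_surjective (Ideal.Quotient.mk I) Ideal.Quotient.mk_surjective
    (RingHom.ker (eval v))
  rw [htop, Ideal.comap_top, ← RingHom.ker_eq_comap_bot, Ideal.mk_ker, sup_eq_left.mpr hv] at h
  exact h.symm

/-- **`H⁽¹⁾(𝒪_{C,v})(d) = dim_K S/(I + 𝔪_v^{d+1})`** for a rational point `v ∈ C(K)` of the cone
(or of any closed subscheme `V(I) ⊆ 𝔸ⁿ`: homogeneity is not used), `𝒪_{C,v}` being any localization of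
`S/I` at the maximal ideal `𝔪_v/I` (`isMaximal_map_ker_eval`). [cite: CossartJannsenSaito2020, §2.2 (p. 27)] -/
theorem hilbertSamuelFun_one_localization_cone_eq (I : Ideal (MvPolynomial (Fin n) K)) (v : Fin n → K)
    [((RingHom.ker (eval v)).map (Ideal.Quotient.mk I)).IsMaximal]
    (L : Type u) [CommRing L] [Algebra (MvPolynomial (Fin n) K ⧸ I) L] [Algebra K L]
    [IsScalarTower K (MvPolynomial (Fin n) K ⧸ I) L]
    [IsLocalization.AtPrime L ((RingHom.ker (eval v)).map (Ideal.Quotient.mk I))]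
    [IsLocalRing L] [IsNoetherianRing L] (d : ℕ) :
    hilbertSamuelFun L 1 d = finrank K (MvPolynomial (Fin n) K ⧸ (I ⊔ RingHom.ker (eval v) ^ (d + 1))) := by
  set 𝔑 : Ideal (MvPolynomial (Fin n) K ⧸ I) := (RingHom.ker (eval v)).map (Ideal.Quotient.mk I)
  have hrat : ∀ r : MvPolynomial (Fin n) K ⧸ I, ∃ c : K, r - algebraMap K _ c ∈ 𝔑 := by
    intro r
    obtain ⟨f, rfl⟩ := Ideal.Quotient.mk_surjective r
    refine ⟨eval v f, ?_⟩
    rw [IsScalarTower.algebraMap_apply K (MvPolynomial (Fin n) K) (MvPolynomial (Fin n) K ⧸ I),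
      Ideal.Quotient.algebraMap_eq, MvPolynomial.algebraMap_eq, ← map_sub]
    exact Ideal.mem_map_of_mem _ (by rw [RingHom.mem_ker, map_sub, eval_C, sub_self])
  -- `R/𝔑^{d+1} ≅ S/(I + 𝔪_v^{d+1})`
  have h𝔑pow : 𝔑 ^ (d + 1) = (RingHom.ker (eval v) ^ (d + 1)).map (Ideal.Quotient.mkₐ K I) := by
    rw [Ideal.map_pow]
    rfl
  let e : ((MvPolynomial (Fin n) K ⧸ I) ⧸ 𝔑 ^ (d + 1)) ≃ₐ[K]
      MvPolynomial (Fin n) K ⧸ (I ⊔ RingHom.ker (eval v) ^ (d + 1)) :=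
    (Ideal.quotientEquivAlgOfEq K h𝔑pow).trans (DoubleQuot.quotQuotEquivQuotSupₐ K I _)
  haveI := finite_quotient_sup_ker_eval_pow I v d
  haveI : Module.Finite K ((MvPolynomial (Fin n) K ⧸ I) ⧸ 𝔑 ^ (d + 1)) :=
    Module.Finite.equiv e.toLinearEquiv.symm
  rw [hilbertSamuelFun_one_eq_finrank_quotient_pow 𝔑 L hrat d, e.toLinearEquiv.finrank_eq]

/-! ## The cone theorem in the Hilbert–Samuel vocabulary of CJS §2.2 / Def. 2.28 -/

section ConeTheorem

variable {I : Ideal (MvPolynomial (Fin n) K)} (hI : IsHomogeneousIdeal I) (v : Fin n → K)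
  [((RingHom.ker (eval v)).map (Ideal.Quotient.mk I)).IsMaximal]
  [((RingHom.ker (eval (0 : Fin n → K))).map (Ideal.Quotient.mk I)).IsMaximal]
  (Lv : Type u) [CommRing Lv] [Algebra (MvPolynomial (Fin n) K ⧸ I) Lv] [Algebra K Lv]
  [IsScalarTower K (MvPolynomial (Fin n) K ⧸ I) Lv]
  [IsLocalization.AtPrime Lv ((RingHom.ker (eval v)).map (Ideal.Quotient.mk I))]
  [IsLocalRing Lv] [IsNoetherianRing Lv]
  (L₀ : Type u) [CommRing L₀] [Algebra (MvPolynomial (Fin n) K ⧸ I) L₀] [Algebra K L₀]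
  [IsScalarTower K (MvPolynomial (Fin n) K ⧸ I) L₀]
  [IsLocalization.AtPrime L₀ ((RingHom.ker (eval (0 : Fin n → K))).map (Ideal.Quotient.mk I))]
  [IsLocalRing L₀] [IsNoetherianRing L₀]

include hI in
/-- **The Hilbert function of the local ring of a cone at its vertex is the Hilbert function of its
graded coordinate ring**: `H⁽⁰⁾(𝒪_{C,0}) = H(S/I)` (CJS §2.2: "the Hilbert function is that of the
associated graded ring", for the graded ring `S/I`, whose own associated graded ring it is).
[cite: CossartJannsenSaito2020, §2.2 (p. 27)] -/
theorem hilbertFun_localization_vertex_eq_hilbertFunQuot : hilbertFun L₀ = hilbertFunQuot K n I := by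
  apply psum_injective
  funext d
  have h := hilbertSamuelFun_one_localization_cone_eq I (0 : Fin n → K) L₀ d
  rw [ker_eval_zero, finrank_quotient_sup_pow_eq_psum_hilbertFunQuot hI] at h
  rw [← h]
  rfl

include hI v in
/-- **Semicontinuity along the cone, local rings**: `H⁽¹⁾(𝒪_{C,v}) ≤ H⁽¹⁾(𝒪_{C,0})` pointwise for every
rational point `v ∈ C(K)` of the cone of a homogeneous ideal. [folklore] -/
theorem hilbertSamuelFun_one_localization_cone_le : hilbertSamuelFun Lv 1 ≤ hilbertSamuelFun L₀ 1 := by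
  intro d
  rw [hilbertSamuelFun_one_localization_cone_eq I v Lv d,
    hilbertSamuelFun_one_localization_cone_eq I (0 : Fin n → K) L₀ d, ker_eval_zero]
  exact finrank_quotient_sup_ker_eval_pow_le hI v d

include hI in
/-- **The cone theorem, Hilbert–Samuel form (Hironaka 1970 / Giraud 1975 §1.5; every characteristic):
a rational point `v ∈ C(K)` of the cone `C = V(I)` of a homogeneous ideal lies in Giraud's ridge `F(C)(K)`
iff it is NEAR to the vertex in the sense of CJS Def. 3.13, `H⁽¹⁾(𝒪_{C,v}) = H⁽¹⁾(𝒪_{C,0})`.**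
[cite: Giraud1975, §1.5] -/
theorem mem_ridge_iff_hilbertSamuelFun_eq :
    v ∈ ridge K I ↔ hilbertSamuelFun Lv 1 = hilbertSamuelFun L₀ 1 := by
  rw [mem_ridge_iff_finrank_quotient_ker_eval_eq hI v, funext_iff]
  refine forall_congr' fun d => ?_
  rw [hilbertSamuelFun_one_localization_cone_eq I v Lv d,
    hilbertSamuelFun_one_localization_cone_eq I (0 : Fin n → K) L₀ d, ker_eval_zero]

include hI in
/-- **The same with the Hilbert functions `H⁽⁰⁾` themselves** (`ν ↦ ν⁽¹⁾` is injective, CJS Rem. 2.29 (b)):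
`v ∈ F(C)(K) ↔ H⁽⁰⁾(𝒪_{C,v}) = H⁽⁰⁾(𝒪_{C,0})`; with `hilbertFun_localization_vertex_eq_hilbertFunQuot`,
`↔ H⁽⁰⁾(𝒪_{C,v}) = H(S/I)`. [cite: Giraud1975, §1.5] -/
theorem mem_ridge_iff_hilbertFun_eq : v ∈ ridge K I ↔ hilbertFun Lv = hilbertFun L₀ := by
  rw [mem_ridge_iff_hilbertSamuelFun_eq hI v Lv L₀]
  exact (iterPSum_injective 1).eq_iff

include hI v in
/-- **Near ⟹ in the ridge**, Hilbert-function form: if `H⁽¹⁾(𝒪_{C,0}) ≤ H⁽¹⁾(𝒪_{C,v})` pointwise (no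
drop of the Hilbert–Samuel function at the rational point `v`), then `f(X + v) ∈ I` for all `f ∈ I` and
`v ∈ F(C)(K)`. [cite: Giraud1975, §1.5] -/
theorem mem_ridge_of_hilbertSamuelFun_le (h : hilbertSamuelFun L₀ 1 ≤ hilbertSamuelFun Lv 1) :
    v ∈ ridge K I := by
  refine mem_ridge_of_finrank_quotient_ker_eval_le hI v fun d => ?_
  have hd := h d
  rw [hilbertSamuelFun_one_localization_cone_eq I v Lv d,
    hilbertSamuelFun_one_localization_cone_eq I (0 : Fin n → K) L₀ d, ker_eval_zero] at hd
  exact hd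

end ConeTheorem

end CampaignW42

end Summit.ResolutionOfSingularities.ResolutionOfSingularities.Theorems
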